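import Summits.BirchSwinnertonDyer.BirchSwinnertonDyer.Theorems.KolyvaginRoadThreeMethod2KolyvaginPerfCocycles
import Literature.NumberTheory.EllipticCurves.InertiaTameFactorizationProofs
import HarnessLib

/-!
# KOLY method line, crux stmt-BirchSwinnertonDyer-19574 `ZhangSharpFrameAtThreeHL`, stub S2-ENGINE: THE CORE OF (Perf) —
# rank-one cup-product cocycles, and the character identity `m = j·n + k·w₀` on `Γ_{K_λ}`
# (cell `bsd-stepL`, seat `bsd-stepL-zhang3-p1` g9; `--supports 19574`, helper)

Two abstract-ish lemmas through which `…KolyvaginPerf` proves the binder (Perf) `hperf` of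
`Method2.triangulation_of_kolyvaginLocal` (p508963) structurally:

* `twoCocycleClass_ne_zero_of_rank_one` (group cohomology, exponent `3`): two continuous `2`-cocycles of the shape
  `c(σ, τ) = k_σ · n(τ)`, `c'(σ, τ) = k_σ · m(τ)` along an additive `f = k · P` (`P` of order `3`), whose characters
  satisfy `m - j·n = k · w₀` with `w₀` fixed by `G`, have `[c'] = j · [c]` (the difference is the symmetric cocycle
  `k_σ k_τ w₀`, a coboundary: `twoCocycleClass_eq_zero_of_symmetric`); so `[c'] ≠ 0 ⟹ [c] ≠ 0`.
* `exists_sub_zsmul_eq_nsmul` (the character identity at a finite place `v ∤ 3` of a number field with uniformiser in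
  `K`): for additive continuous `f : Γ_{K_v} → M` unramified (killing the preimage of `I_𝔓`) with `f(g_F)` of order `3`
  at a Frobenius lift `g_F`, and additive continuous `n, m : Γ_{K_v} → μ₃` with `n` RAMIFIED, there are `j ∈ ℤ`,
  `w₀ ∈ μ₃` with `m τ - j · n τ = k · w₀` whenever `f τ = k · f(g_F)` — from `G_𝔓 = ⟨F⟩ · I_𝔓 · U`
  (`exists_eq_frobenius_pow_mul_of_mem_decompositionSubgroup`, Krull pushdown, continuous lift `G_𝔓 → Γ_{K_v}`) and the
  SIMULTANEOUS tame factorisation of `(n, m)` on `I_𝔓` (`InertiaTame.exists_forall_apply_eq_nsmul`: the values of a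
  continuous additive map on inertia into a finite `3`-torsion group lie on one line).

References: B. Mazur, K. Rubin, Mem. AMS 799 (2004), Prop. 1.3.2; J. Neukirch, *ANT*, I (9.4), II (9.6); J.-P. Serre,
*Local Fields*, IV §2 (tame inertia).
-/

noncomputable section

open scoped Classical Pointwise

namespace Summit.BirchSwinnertonDyer.Rank1Residual.X11b.Three.Koly.Method2.KolyLocal

open CategoryTheory WeierstrassCurve Field Function NumberField IsDedekindDomain
open Literature.NumberTheory.EllipticCurves Literature.NumberTheory.GaloisRepresentations Module
open Literature.NumberTheory.GaloisRepresentations.DiscreteGaloisModule (mu MuCarrier)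
open Literature.NumberTheory.GaloisCohomology
open scoped ContRepresentation

attribute [local instance] absoluteGaloisGroup_compactSpace

universe v

/-! ## §1 Rank-one cup-product cocycles -/

/-- `k • w` only depends on `k • P` for `P` of order `3` and `3 • w = 0`. [folklore] -/
theorem nsmul_eq_nsmul_of_nsmul_eq {A B : Type*} [AddCommGroup A] [AddCommGroup B] {P : A} (hP : addOrderOf P = 3)
    {w : B} (hw : (3 : ℕ) • w = 0) {k k' : ℕ} (h : k • P = k' • P) : k • w = k' • w := by
  have hmod : k ≡ k' [MOD 3] := by rw [← hP]; exact nsmul_eq_nsmul_iff_modEq.mp h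
  have hred : ∀ m : ℕ, m • w = (m % 3) • w := fun m ↦ by
    conv_lhs => rw [← Nat.mod_add_div m 3, add_nsmul, mul_nsmul, hw, nsmul_zero, add_zero]
  rw [hred k, hred k', hmod]

/-- **Rank-one cup-product cocycles: `[c'] ≠ 0 ⟹ [c] ≠ 0`.** Let `f : G → M` be continuous additive with `f σ = k_σ P`,
`P` of order `3` (`3M = 0`), and `c, c'` continuous `2`-cocycles with values in a `3`-torsion `Z` of the shape
`c(σ, τ) = k_σ · n(τ)`, `c'(σ, τ) = k_σ · m(τ)`; if `m τ - j · n τ = k_τ · w₀` for a `G`-fixed `w₀`, then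
`c' - j·c = (σ, τ) ↦ k_σ k_τ w₀` is a coboundary (`twoCocycleClass_eq_zero_of_symmetric`), so `[c'] = j [c]`.
[cite: MazurRubin2004, Prop. 1.3.2 (proof)] -/
theorem twoCocycleClass_ne_zero_of_rank_one {G : Type v} [Group G] [TopologicalSpace G] [IsTopologicalGroup G]
    [LocallyCompactSpace G] (Z : TopRep.{v} ℤ G) {M : Type*} [AddCommGroup M] [TopologicalSpace M] [DiscreteTopology M]
    (f : C(G, M)) (hf : ∀ σ τ, f (σ * τ) = f σ + f τ) {P : M} (hP3 : addOrderOf P = 3) (hM3 : ∀ a : M, 3 • a = 0)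
    (hrank : ∀ σ, ∃ k : ℕ, f σ = k • P) (n m : G → Z) (c c' : contTwoCocycles Z)
    (hc : ∀ σ τ (k : ℕ), f σ = k • P → c.1 (σ, τ) = k • n τ)
    (hc' : ∀ σ τ (k : ℕ), f σ = k • P → c'.1 (σ, τ) = k • m τ)
    (h3Z : ∀ z : Z, 3 • z = 0) {j : ℤ} {w₀ : Z} (hw₀ : ∀ g, Z.ρ g w₀ = w₀)
    (hkey : ∀ τ (k : ℕ), f τ = k • P → m τ - j • n τ = k • w₀) (hne : twoCocycleClass Z c' ≠ 0) :
    twoCocycleClass Z c ≠ 0 := by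
  haveI : Fact (Nat.Prime 3) := ⟨Nat.prime_three⟩
  letI : Module (ZMod 3) M := AddCommGroup.zmodModule hM3
  letI : Module (ZMod 3) Z := AddCommGroup.zmodModule h3Z
  have hP0 : P ≠ 0 := fun h0 ↦ by rw [h0, addOrderOf_zero] at hP3; exact absurd hP3 (by norm_num)
  obtain ⟨π, hπ⟩ := Module.Projective.exists_dual_eq_one (ZMod 3) hP0
  have hπk : ∀ {g} {k : ℕ}, f g = k • P → π (f g) = (k : ZMod 3) := fun {g k} hk ↦ by
    rw [hk, map_nsmul, hπ, nsmul_eq_mul, mul_one]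
  have hzmod : ∀ (a : ZMod 3) (z : Z), a • z = a.val • z := fun a z ↦ by
    conv_lhs => rw [← ZMod.natCast_zmod_val a]
    rw [Nat.cast_smul_eq_nsmul]
  have hc₀ : twoCocycleClass Z (c' - j • c) = 0 := by
    refine twoCocycleClass_eq_zero_of_symmetric Z f hf (fun a b ↦ (π a * π b) • w₀)
      (fun a a' b ↦ by simp only [map_add, add_mul, add_smul]) (fun a b b' ↦ by simp only [map_add, mul_add, add_smul])
      (fun σ τ ↦ by rw [mul_comm]) (fun σ τ ↦ h3Z _) (fun g σ τ ↦ by rw [hzmod, map_nsmul, hw₀]) _ fun σ τ ↦ ?_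
    obtain ⟨kσ, hkσ⟩ := hrank σ
    obtain ⟨kτ, hkτ⟩ := hrank τ
    change c'.1 (σ, τ) - j • c.1 (σ, τ) = (π (f σ) * π (f τ)) • w₀
    rw [hc' σ τ kσ hkσ, hc σ τ kσ hkσ, hπk hkσ, hπk hkτ, mul_smul, Nat.cast_smul_eq_nsmul, Nat.cast_smul_eq_nsmul,
      ← hkey τ kτ hkτ, smul_sub, smul_comm kσ j]
  have hsm : twoCocycleClass Z (j • c) = j • twoCocycleClass Z c := map_zsmul (twoCocycleClassₗ Z) j c
  have hcls : twoCocycleClass Z c' = j • twoCocycleClass Z c := by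
    rw [twoCocycleClass_sub, hsm, sub_eq_zero] at hc₀
    exact hc₀
  intro h0
  apply hne
  rw [hcls, h0]
  exact zsmul_zero j

/-! ## §2 The character identity on `Γ_{K_v}` -/

section Place

variable (K : Type) [Field K] [NumberField K] (v : HeightOneSpectrum (𝓞 K))

/-- **The character identity `m = j·n + k·w₀` on `Γ_{K_v}`.** At a finite place `v ∤ 3` with a uniformiser `π₀ ∈ K`, let
`F` be an arithmetic Frobenius at the prime `𝔓 ∣ v` cut out by the chosen embedding, `g_F ∈ Γ_{K_v}` a lift,
`f : Γ_{K_v} → M` continuous additive, killing the preimage of `I_𝔓`, with `f(g_F)` of order `3`, and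
`n, m : Γ_{K_v} → μ₃(K̄)` continuous additive with `n` ramified. Then there are `j ∈ ℤ`, `w₀ ∈ μ₃` with
`m τ - j · n τ = k · w₀` whenever `f τ = k · f(g_F)`. Proof: write `τ = g_F^{k'} g_i g_u` (`res τ = F^{k'} i u`,
`exists_eq_frobenius_pow_mul_of_mem_decompositionSubgroup`, with `u` in an open subgroup killing `n, m, f`, and lifts);
on `I_𝔓` the pair `(n, m) ∘ lift` takes values on one line `ℕ · (n₁, m₁)` (`InertiaTame.exists_forall_apply_eq_nsmul`),
`n₁ ≠ 0` generates `μ₃`, `m₁ = j n₁`; then `m τ - j n τ = k' (m(g_F) - j n(g_F))` and `k' ≡ k (mod 3)`.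
[cite: NeukirchANT1999, I §9 Prop. (9.4)] [cite: SerreLocalFields1979, IV §2] -/
theorem exists_sub_zsmul_eq_nsmul {𝔐 : Ideal (HeightOneSpectrum.localAbsIntegers v)} (h𝔐 : 𝔐 ∈ v.localPrimesAbove)
    (h3v : ((3 ^ 1 : ℕ) : 𝓞 K) ∉ v.asIdeal) {π₀ : K} (hπ₀ : v.valuation K π₀ = WithZero.exp (-1 : ℤ))
    {F : absoluteGaloisGroup K} (hF : IsArithFrobAt (𝓞 K) F (v.primeBelow (closureEmb (K := K) (v.adicCompletion K)) 𝔐))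
    {gF : absoluteGaloisGroup (v.adicCompletion K)} (hgF : absGaloisRestrict K (v.adicCompletion K) gF = F)
    {M : Type*} [AddCommGroup M] [TopologicalSpace M] [DiscreteTopology M]
    (f : C(absoluteGaloisGroup (v.adicCompletion K), M)) (hf : ∀ g g', f (g * g') = f g + f g')
    (hfI : ∀ g, absGaloisRestrict K (v.adicCompletion K) g ∈
      (v.primeBelow (closureEmb (K := K) (v.adicCompletion K)) 𝔐).inertia (absoluteGaloisGroup K) → f g = 0)
    (hP3 : addOrderOf (f gF) = 3)
    (n m : C(absoluteGaloisGroup (v.adicCompletion K), MuCarrier K (3 ^ 1)))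
    (hn : ∀ g g', n (g * g') = n g + n g') (hm : ∀ g g', m (g * g') = m g + m g')
    (hram : ∃ g, absGaloisRestrict K (v.adicCompletion K) g ∈
      (v.primeBelow (closureEmb (K := K) (v.adicCompletion K)) 𝔐).inertia (absoluteGaloisGroup K) ∧ n g ≠ 0) :
    ∃ (j : ℤ) (w₀ : MuCarrier K (3 ^ 1)), ∀ (τ : absoluteGaloisGroup (v.adicCompletion K)) (k : ℕ),
      f τ = k • f gF → m τ - j • n τ = k • w₀ := by
  set Kv := v.adicCompletion K with hKv
  set D := (v.primeBelow (closureEmb (K := K) Kv) 𝔐).decompositionSubgroup (absoluteGaloisGroup K) with hDdef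
  set I := (v.primeBelow (closureEmb (K := K) Kv) 𝔐).inertia (absoluteGaloisGroup K) with hIdef
  have h𝔓 : v.primeBelow (closureEmb (K := K) Kv) 𝔐 ∈ v.primesAbove := HeightOneSpectrum.primeBelow_mem_primesAbove h𝔐
  have hinj : Injective (absGaloisRestrict K Kv) := absGaloisRestrict_adicCompletion_injective K v
  have hres : ∀ g : absoluteGaloisGroup Kv, absGaloisRestrict K Kv g ∈ D := fun g ↦ by
    rw [hDdef, ← resGal_eq_absGaloisRestrict, resGal_eq]; exact resGalOfEmb_mem_decompositionSubgroup _ h𝔐 g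
  have hID : I ≤ D := Ideal.inertia_le_stabilizer _
  -- `μ₃`: `3`-torsion, of order `3`
  have hμ3 : ∀ z : MuCarrier K (3 ^ 1), 3 • z = 0 := fun z ↦ by
    rw [← natCast_zsmul]; exact zsmul_muCarrier_eq_zero K (3 ^ 1) z
  have hcmu : Nat.card (MuCarrier K (3 ^ 1)) = 3 := by
    change Nat.card (rootsOfUnity (3 ^ 1) (AlgebraicClosure K)) = 3
    rw [HasEnoughRootsOfUnity.natCard_rootsOfUnity]; norm_num
  haveI : Finite (MuCarrier K (3 ^ 1)) := Nat.finite_of_card_ne_zero (by rw [hcmu]; norm_num)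
  -- additive maps vanish at `1` and on powers
  have h1 : ∀ (θ : C(absoluteGaloisGroup Kv, MuCarrier K (3 ^ 1))), (∀ τ τ', θ (τ * τ') = θ τ + θ τ') → θ 1 = 0 :=
    fun θ hθ ↦ by have h := hθ 1 1; rw [mul_one] at h; exact left_eq_add.mp h
  have hpow : ∀ (θ : C(absoluteGaloisGroup Kv, MuCarrier K (3 ^ 1))), (∀ τ τ', θ (τ * τ') = θ τ + θ τ') →
      ∀ N : ℕ, θ (gF ^ N) = N • θ gF := by
    intro θ hθ N
    induction N with
    | zero => rw [pow_zero, h1 θ hθ, zero_smul]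
    | succ N ih => rw [pow_succ gF N, hθ, ih, succ_nsmul]
  have hf1 : f 1 = 0 := by have h := hf 1 1; rw [mul_one] at h; exact left_eq_add.mp h
  have hpow_f : ∀ N : ℕ, f (gF ^ N) = N • f gF := fun N ↦ by
    induction N with
    | zero => rw [pow_zero, hf1, zero_smul]
    | succ N ih => rw [pow_succ gF N, hf, ih, succ_nsmul]
  -- ### the continuous lift `L : D → Γ_{K_v}` and the pair `a = (n, m) ∘ L` on `I_𝔓`
  obtain ⟨L, hLc, hL, hLmul⟩ := exists_continuous_lift_decompositionSubgroup K v h𝔐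
  let a : I → MuCarrier K (3 ^ 1) × MuCarrier K (3 ^ 1) := fun i ↦ (n (L ⟨i, hID i.2⟩), m (L ⟨i, hID i.2⟩))
  have ha : ∀ i, a i = (n (L ⟨i, hID i.2⟩), m (L ⟨i, hID i.2⟩)) := fun _ ↦ rfl
  have hLi : Continuous fun i : I ↦ L ⟨i, hID i.2⟩ := hLc.comp (Continuous.subtype_mk continuous_subtype_val _)
  have hac : Continuous a := (n.continuous.comp hLi).prodMk (m.continuous.comp hLi)
  have haa : ∀ i i', a (i * i') = a i + a i' := fun i i' ↦ by
    rw [ha, ha, ha, Prod.mk_add_mk, ← hn, ← hm, ← hLmul]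
    rfl
  have hT : ∀ t : MuCarrier K (3 ^ 1) × MuCarrier K (3 ^ 1), (3 ^ 1) • t = 0 := fun t ↦ Prod.ext (hμ3 t.1) (hμ3 t.2)
  obtain ⟨z, hz⟩ := IsAlgClosed.exists_pow_nat_eq (algebraMap K (AlgebraicClosure K) π₀) (by norm_num : 0 < 3 ^ 1)
  obtain ⟨σ₁, -, hσ₁⟩ := InertiaTame.exists_forall_apply_eq_nsmul v (by norm_num : 0 < 3 ^ 1) h3v hπ₀ hz h𝔓 hT a hac haa
  set n₁ := n (L ⟨σ₁, hID σ₁.2⟩) with hn₁def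
  set m₁ := m (L ⟨σ₁, hID σ₁.2⟩) with hm₁def
  have ha₁ : a σ₁ = (n₁, m₁) := ha σ₁
  -- `n` ramified ⟹ `n₁ ≠ 0`
  have hn₁ : n₁ ≠ 0 := by
    obtain ⟨g, hgI, hg0⟩ := hram
    intro h0
    apply hg0
    obtain ⟨kᵢ, hkᵢ⟩ := hσ₁ ⟨_, hgI⟩
    have hg : L ⟨absGaloisRestrict K Kv g, hID hgI⟩ = g := hinj (hL _)
    have h1 : (a ⟨_, hgI⟩).1 = n g := by rw [ha]; change n (L ⟨absGaloisRestrict K Kv g, _⟩) = n g; rw [hg]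
    rw [← h1, hkᵢ, ha₁, Prod.smul_fst, h0, smul_zero]
  -- `μ₃ = ℤ n₁`, `m₁ = j n₁`
  obtain ⟨j, hj⟩ : ∃ j : ℤ, j • n₁ = m₁ := by
    have hord : addOrderOf n₁ = 3 := addOrderOf_eq_prime (hμ3 n₁) hn₁
    have htop : AddSubgroup.zmultiples n₁ = ⊤ :=
      AddSubgroup.eq_top_of_card_eq _ (by rw [Nat.card_zmultiples, hord, hcmu])
    exact AddSubgroup.mem_zmultiples_iff.mp (htop ▸ AddSubgroup.mem_top m₁)
  refine ⟨j, m gF - j • n gF, fun τ k hk ↦ ?_⟩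
  -- ### decompose `τ = g_F ^ k' · g_i · g_u`
  have hO : IsOpen (n ⁻¹' {0} ∩ m ⁻¹' {0} ∩ f ⁻¹' {0}) :=
    (((isOpen_discrete ({0} : Set (MuCarrier K (3 ^ 1)))).preimage n.continuous).inter
      ((isOpen_discrete ({0} : Set (MuCarrier K (3 ^ 1)))).preimage m.continuous)).inter
      ((isOpen_discrete ({0} : Set M)).preimage f.continuous)
  have h1O : (1 : absoluteGaloisGroup Kv) ∈ n ⁻¹' {0} ∩ m ⁻¹' {0} ∩ f ⁻¹' {0} := ⟨⟨h1 n hn, h1 m hm⟩, hf1⟩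
  obtain ⟨U, hU, hUO⟩ := exists_isOpen_subgroup_absGaloisRestrict_mem K v hO h1O
  obtain ⟨k', i', u, hi', hu, hdec⟩ := exists_eq_frobenius_pow_mul_of_mem_decompositionSubgroup h𝔓 hF hU (hres τ)
  set gi := L ⟨i', hID hi'⟩ with hgidef
  have hgi : absGaloisRestrict K Kv gi = i' := hL _
  set gu := (gF ^ k' * gi)⁻¹ * τ with hgudef
  have hgu : absGaloisRestrict K Kv gu = u := by
    rw [hgudef, map_mul, map_inv, map_mul, map_pow, hgF, hgi, hdec, inv_mul_cancel_left]
  have hτ : τ = gF ^ k' * gi * gu := by rw [hgudef, mul_inv_cancel_left]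
  obtain ⟨⟨hnu, hmu⟩, hfu⟩ := hUO gu (hgu ▸ hu)
  have hfi : f gi = 0 := hfI gi (by rw [hgi]; exact hi')
  have hfτ : f τ = k' • f gF := by rw [hτ, hf, hf, hpow_f, hfi, hfu, add_zero, add_zero]
  obtain ⟨kᵢ, hkᵢ⟩ := hσ₁ ⟨i', hi'⟩
  rw [ha, ha₁] at hkᵢ
  have hngi : n gi = kᵢ • n₁ := by have := congrArg Prod.fst hkᵢ; rwa [Prod.smul_fst] at this
  have hmgi : m gi = kᵢ • m₁ := by have := congrArg Prod.snd hkᵢ; rwa [Prod.smul_snd] at this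
  have hnτ : n τ = k' • n gF + kᵢ • n₁ := by rw [hτ, hn, hn, hpow n hn, hngi, hnu, add_zero]
  have hmτ : m τ = k' • m gF + kᵢ • m₁ := by rw [hτ, hm, hm, hpow m hm, hmgi, hmu, add_zero]
  have hkk' : k • (m gF - j • n gF) = k' • (m gF - j • n gF) :=
    nsmul_eq_nsmul_of_nsmul_eq hP3 (hμ3 _) (hk.symm.trans hfτ)
  rw [hkk', hnτ, hmτ, ← hj]
  module

end Place

end Summit.BirchSwinnertonDyer.Rank1Residual.X11b.Three.Koly.Method2.KolyLocal

end
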